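import Literature.MathematicalPhysics.QuantumFieldTheory.Balaban1983to89.B16ZLower
import Literature.MathematicalPhysics.QuantumFieldTheory.Balaban1983to89.HaarSmallBallClosedSubgroup

/-!
# `Balaban1983to89.B16ZLowerCompactGroup` — the gauge-fixing normalisation `z` of [Balaban1987RG1] (0.15): the
# reader's item `log z ≥ d(𝔤)·log g_j − C_z` (`B16B10Shape.CountertermData.ZLower`) DISCHARGED FOR EVERY COMPACT
# GAUGE GROUP PRESENTED IN `U(N)` — print's standing generality «G ⊂ U(N) a Lie subgroup», exponent `d(𝔤) = dim 𝔤`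

statement-level skeleton of published theorems with citation tags; proofs where landed; nothing here is a claim about
the Yang–Mills mass gap

CITATION HEADER.  Cell `lit-balaban` (Phase-2 proof seat p24, gen 9; free-target protocol G.5-34(d), own Lie-theory
lane; HOME `run/shared/lean/pub/lit-balaban/`, seat dir `lit-balaban-p24/`).  Source: T. Bałaban, *Renormalization
group approach to lattice gauge field theories. I*, Commun. Math. Phys. **109** (1987) 249–301 [Balaban1987RG1] (cell
paper B12; PDF held `paper:balaban1987-cmp109-rg-i-small-field`, journal page = PDF page + 248): §0 pp. 251–252
[PDF 3–4] «Field configurations have values in a compact Lie group G. … We assume that G is semisimple and that it is a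
Lie subgroup of a group of complex unitary matrices, for example G ⊂ U(N). (In fact a bigger part of our considerations
does not depend on the semisimplicity assumption.) A Lie algebra of the group G is denoted by 𝐠»; (0.15) p. 254 [PDF 6]
«(1/z)∫du(x) exp[−(1/α)[1 − Re tr U(y,x)u⁻¹(x)]]χ({|U(y,x)u⁻¹(x) − 1| < ε₀}) = (1/z)∫du(x) exp[−(1/α)[1 − Re tr u(x)]]
χ({|u(x) − 1| < ε₀}) = 1», p. 255 l. 1 «where z is defined by the last integral»; (0.17)/(0.19) p. 255: `α = g_k²`.
The reader's item: T. Bałaban, *Convergent renormalization expansions for lattice gauge theories*, Commun. Math.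
Phys. **119** (1988) 243–285 [Balaban1988Convergent] (1.15) p. 249 «+ log g₀ d(𝐠)|Ω₁*| + log σ₀|Ω₁*| − log z(L⁴ − 1)
|Ω₁^{(1)}|» and [Balaban1989LargeFieldII] p. 356 «(−½d(g) log g_k⁻² + log σ₀)|Λ^{(k)}∖G₀|», read by the cell's
`B16B10Shape.CountertermData.ZLower Cz : ∀ j < K, d(𝔤)·log g_j − C_z ≤ log z_j` («READER'S ITEM (labelled; elementary
Laplace LOWER bound, not printed)»).  Small-ball input: [VaropoulosSaloffcosteCoulhon1993] Thm. V.4.1 («C⁻¹t^d < V(t)»),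
kernel-proved for compact linear groups in `HaarSmallBallClosedSubgroup` (this seat, file 1).

WHAT THE TREE HAD.  `B16ZLower` (pub-balaban lineage pv24): the transcription `zNorm G α ε₀` of (0.15) over the cell's
abstract gauge group (`GaugeGroup` + `HaarData`), the abstract Laplace bound `zNorm_ge_of_subset`, and the item
DISCHARGED for `G = U(N)` (`zLower_of_unitaryGroup`, `dg = N²`, explicit `C_z`) and `G = SU(N)`
(`zLower_of_specialUnitaryGroup`, `dg = N² − 1`, explicit `C_z^{SU}`); its header, «SCOPE, stated honestly»: «For a
general closed subgroup G ⊂ U(N) the same Laplace step applies verbatim (§1 is abstract), and the only missing input is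
the Haar small-ball bound ON G with the exponent d(𝔤), Haar_G{|u − 1| ≤ ρ} ≥ c_G·ρ^{d(𝔤)} (a Lie-chart statement
Mathlib does not yet offer in general; NOT claimed here beyond U(N) and SU(N)).»

WHAT THIS FILE PROVES (0 `sorry`; theorems only; no definition, no `Prop`-valued fact; standard axioms).  Setting =
the cell's abstract gauge group AT PRINT'S GENERALITY: `G` with `[GaugeGroup G] [MeasurableSpace G]
[RegularGaugeGroup G] [HaarData G]`, compact (`[TopologicalSpace G] [IsTopologicalGroup G] [CompactSpace G]
[BorelSpace G]`), PRESENTED IN `U(N)` by a continuous unitary representation `ρ : G →* M_N(ℂ)` through which the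
interface is read — `dist1 g = ‖ρ g − 1‖_op` (B7 (19)) and `reTr g = Re Tr ρ(g)/N` (B12 (0.2)); these two hypotheses
hold by `rfl` for the cell's `U(N)`, `SU(N)` instances and for every `GaugeGroup.ofUnitaryRep` structure (B7 p. 20 «G is
a Lie subgroup of U(N)»).  `HaarData.haar` may be ANY datum of the class (a left-invariant probability measure):
* §1 `one_sub_reTr_le_of_norm_le` (`‖ρ g − 1‖ ≤ r ⟹ 1 − Re tr g ≤ r²/2`, the operator-norm half of (0.14)),
  `haarReal_repBall_ge` (file 1's small-ball bound for the cell's `HaarData.haar`), **`zNorm_ge_of_unitaryRep`**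
  (`z(α, ε₀) ≥ e^{−r²/(2α)}·Haar{‖ρ g − 1‖ ≤ r}`, `0 < r < ε₀`);
* §2 **`log_zNorm_ge_of_unitaryRep`** — THE ITEM AS A THEOREM FOR EVERY SUCH `G`: there is `C_z ≥ 0` (depending on
  `G`, `ρ`, `ε₀` only) with `log z(g², ε₀) ≥ d·log g − C_z` for all `0 < g ≤ 1`, `d = dim_ℝ 𝔤(ρ(G))`
  (`QuantumLattice.matrixLieAlgebra (range ρ)`; for faithful `ρ` this is `dim G`); **`zLower_of_unitaryRep`** — the
  DICTIONARY: `SmallCouplings`, `dg = d` and `logz j = log z(g_j², ε₀)` give `S.ZLower C_z`, so the hypothesis `hz` of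
  `B16B10Shape.negE_lower` ∕ `unitConfigLog_of_leaves` ∕ `ep_lower_of_leaves` is a theorem for every compact gauge group
  presented in `U(N)` (and `hCz : 0 ≤ 4|log σ₀| + C_z` holds by `C_z ≥ 0`);
* §3 the cell's instances re-derived from §2: `zLower_unitaryGroup'` (`dg = N²`) and `zLower_specialUnitaryGroup'`
  (`dg = N² − 1`), now as COROLLARIES of the general theorem (non-explicit `C_z`; the explicit constants `Cz`, `CzSU` of
  `B16ZLower` remain the sharper statements), and `zLower_of_range_eq_closedSubgroup` — a compact `G` presented ONTO a
  closed subgroup `G′ ≤ U(N)` (`ρ(G) = G′`) gets `dg = dim` of the Lie algebra of gen 8's `unitarySubgroupLogChart G′`.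

HONEST SCOPE.  (a) `C_z` is NOT explicit (it inherits the non-explicit small-ball constant of file 1: finite subcover
+ a derivative bound of `exp` by compactness); the item `ZLower` only asks for SOME constant, and its sign condition is
met.  (b) The exponent is `d = dim_ℝ` of the Lie algebra of the IMAGE `ρ(G) ⊆ U(N)`; print's `d(𝐠)` is the dimension
of `𝐠 = Lie(G)` for `G ⊂ U(N)` itself, i.e. `ρ` = the inclusion — the case `zLower_of_unitaryRep` is written for; for a
non-faithful `ρ` the theorem is still true but `d` is the dimension of the presented group.  (c) Semisimplicity plays no
role (print: «a bigger part of our considerations does not depend on the semisimplicity assumption»).  (d) Nothing of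
the renormalization-group analysis of [Balaban1987RG1]∕[Balaban1988Convergent] is asserted: (0.15) is a definition, the
bound is the reader's elementary Laplace estimate, kernel-proved; row heads unchanged (B12.Eq0.15 owner r09; the B16
leaf family owner r13).
-/

noncomputable section

open _root_.MeasureTheory
open scoped Matrix.Norms.L2Operator ENNReal

namespace Literature.MathematicalPhysics.QuantumFieldTheory.Balaban1983to89

namespace B16ZLowerCompactGroup

open B16ZLower UnitaryModel MatrixNorms HaarSmallBallClosedSubgroup B16B10Shape
open Literature.MathematicalPhysics.QuantumLattice (matrixLieAlgebra unitaryFundamentalRep fundamentalRep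
  continuous_unitaryFundamentalRep continuous_fundamentalRep fundamentalRep_mem_unitaryGroup
  finrank_matrixLieAlgebra_unitaryGroup finrank_matrixLieAlgebra_specialUnitaryGroup)
open LogChartClosedSubgroup (unitarySubgroupLogChart)

/-! ## §1 The Laplace bound on a compact gauge group presented in `U(N)` -/

section General

variable {n : Type*} [Fintype n] [DecidableEq n] [Nonempty n]
variable {G : Type*} [GaugeGroup G] [MeasurableSpace G] [RegularGaugeGroup G] [HaarData G]
  [TopologicalSpace G] [IsTopologicalGroup G] [CompactSpace G] [BorelSpace G]
variable (ρ : G →* Matrix n n ℂ) (hρc : Continuous ρ) (hρu : ∀ g, ρ g ∈ Matrix.unitaryGroup n ℂ)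
  (hdist : ∀ g : G, dist1 g = ‖ρ g - 1‖) (hre : ∀ g : G, reTr g = nReTr (ρ g))

omit [MeasurableSpace G] [RegularGaugeGroup G] [HaarData G] [TopologicalSpace G] [IsTopologicalGroup G]
  [CompactSpace G] [BorelSpace G] in
include hρu hre in
/-- On the operator-norm ball `{‖ρ g − 1‖ ≤ r}`: `1 − Re tr g ≤ r²/2` — the operator-norm half `2[1 − Re tr U] ≤
|U − 1|²` of (0.14) (`MatrixNorms.two_mul_one_sub_nReTr_le_opDist1_sq`), read through `reTr g = Re Tr ρ(g)/N`.
[cite: Balaban1987RG1, (0.14) p.254] -/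
theorem one_sub_reTr_le_of_norm_le {r : ℝ} {g : G} (hg : ‖ρ g - 1‖ ≤ r) : 1 - reTr g ≤ r ^ 2 / 2 := by
  have h := two_mul_one_sub_nReTr_le_opDist1_sq (n := n) (hρu g)
  have hd : opDist1 (ρ g) ≤ r := hg
  have hd0 : 0 ≤ opDist1 (ρ g) := opDist1_nonneg _
  have h2 : opDist1 (ρ g) ^ 2 ≤ r ^ 2 := pow_le_pow_left₀ hd0 hd 2
  rw [hre]
  linarith

omit [Nonempty n] [RegularGaugeGroup G] in
include hρc hρu in
/-- **The small-ball bound for the cell's Haar datum**: for every `R > 0` there is `c ∈ (0, 1]` with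
`Haar{g : ‖ρ g − 1‖ ≤ r} ≥ c·r^d` for all `0 < r ≤ R`, `d = dim_ℝ 𝔤(ρ(G))` (file 1,
`haarReal_ball_ge_of_unitaryRep`, applied to the left-invariant probability measure `HaarData.haar`).
[cite: VaropoulosSaloffcosteCoulhon1993, Thm. V.4.1] -/
theorem haarReal_repBall_ge {R : ℝ} (hR : 0 < R) :
    ∃ c : ℝ, 0 < c ∧ c ≤ 1 ∧ ∀ r : ℝ, 0 < r → r ≤ R →
      c * r ^ Module.finrank ℝ (matrixLieAlgebra (Set.range ρ)) ≤
        (HaarData.haar : Measure G).real {g : G | ‖ρ g - 1‖ ≤ r} := by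
  haveI := HaarData.isProb (G := G)
  haveI : (HaarData.haar : Measure G).IsMulLeftInvariant := ⟨HaarData.map_mul_left⟩
  obtain ⟨c, hc, hc1, h⟩ := haarReal_ball_ge_of_unitaryRep ρ hρc hρu hR
  exact ⟨c, hc, hc1, fun r hr hrR => h _ r hr hrR⟩

omit [IsTopologicalGroup G] [CompactSpace G] in
include hρc hρu hdist hre in
/-- **Laplace lower bound for `z` of (0.15) on a compact gauge group presented in `U(N)`**: for `α > 0` and
`0 < r < ε₀`, `z(α, ε₀) ≥ e^{−r²/(2α)}·Haar{g : ‖ρ g − 1‖ ≤ r}` (`B16ZLower.zNorm_ge_of_subset` with `B` = the operator-norm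
ball, which lies in `{|u − 1| < ε₀}` because `dist1 = ‖ρ· − 1‖`, and `c = r²/2` by §1).
[cite: Balaban1987RG1, (0.15) p.254] -/
theorem zNorm_ge_of_unitaryRep {α ε₀ r : ℝ} (hα : 0 < α) (hrε : r < ε₀) :
    Real.exp (-(r ^ 2 / 2 / α)) * (HaarData.haar : Measure G).real {g : G | ‖ρ g - 1‖ ≤ r} ≤ zNorm G α ε₀ := by
  have hsub : {g : G | ‖ρ g - 1‖ ≤ r} ⊆ {u : G | dist1 u < ε₀} := by
    intro g hg
    have hg' : ‖ρ g - 1‖ ≤ r := hg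
    show dist1 g < ε₀
    rw [hdist]
    exact lt_of_le_of_lt hg' hrε
  exact zNorm_ge_of_subset (G := G) hα (measurableSet_repBall ρ hρc r) hsub
    (fun g hg => one_sub_reTr_le_of_norm_le ρ hρu hre hg)

/-! ## §2 The reader's item `log z ≥ d(𝔤)·log g − C_z` for every compact gauge group presented in `U(N)` -/

include hρc hρu hdist hre in
/-- **THE READER'S ITEM AS A THEOREM, AT PRINT'S GENERALITY**: for every compact gauge group `G` presented in `U(N)`
by a continuous unitary representation `ρ` (interface `dist1 = ‖ρ· − 1‖`, `reTr = Re Tr ρ·/N`) and every `ε₀ > 0`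
there is `C_z ≥ 0` such that for all `0 < g ≤ 1`, `log z(g², ε₀) ≥ d·log g − C_z`, `d = dim_ℝ 𝔤(ρ(G))` — take
`r = gε₀/2` in `zNorm_ge_of_unitaryRep`, the small-ball bound `Haar ≥ c·r^d` (`haarReal_repBall_ge` with `R = ε₀/2`),
and `C_z = max{0, ε₀²/8 − log c − d·log(ε₀/2)}`. [cite: Balaban1987RG1, (0.15) p.254] -/
theorem log_zNorm_ge_of_unitaryRep {ε₀ : ℝ} (hε : 0 < ε₀) :
    ∃ Cz : ℝ, 0 ≤ Cz ∧ ∀ g : ℝ, 0 < g → g ≤ 1 →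
      (Module.finrank ℝ (matrixLieAlgebra (Set.range ρ)) : ℝ) * Real.log g - Cz ≤
        Real.log (zNorm G (g ^ 2) ε₀) := by
  set d : ℕ := Module.finrank ℝ (matrixLieAlgebra (Set.range ρ)) with hddef
  obtain ⟨c, hc, -, hball⟩ := haarReal_repBall_ge ρ hρc hρu (R := ε₀ / 2) (by positivity)
  refine ⟨max 0 (ε₀ ^ 2 / 8 - Real.log c - d * Real.log (ε₀ / 2)), le_max_left _ _, fun g hg hg1 => ?_⟩
  set r : ℝ := g * ε₀ / 2 with hrdef
  have hr : 0 < r := by positivity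
  have hgε : g * ε₀ ≤ 1 * ε₀ := mul_le_mul_of_nonneg_right hg1 hε.le
  have hrR : r ≤ ε₀ / 2 := by rw [hrdef]; linarith
  have hrε : r < ε₀ := by linarith
  have hz := zNorm_ge_of_unitaryRep ρ hρc hρu hdist hre (α := g ^ 2) (ε₀ := ε₀) (r := r) (by positivity) hrε
  have hb := hball r hr hrR
  have hL : 0 < Real.exp (-(r ^ 2 / 2 / g ^ 2)) * (c * r ^ d) := by positivity
  have hz' : Real.exp (-(r ^ 2 / 2 / g ^ 2)) * (c * r ^ d) ≤ zNorm G (g ^ 2) ε₀ :=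
    le_trans (mul_le_mul_of_nonneg_left hb (Real.exp_nonneg _)) hz
  refine le_trans ?_ (Real.log_le_log hL hz')
  rw [Real.log_mul (Real.exp_pos _).ne' (by positivity), Real.log_exp,
    Real.log_mul hc.ne' (by positivity), Real.log_pow]
  have h1 : r ^ 2 / 2 / g ^ 2 = ε₀ ^ 2 / 8 := by
    rw [hrdef]; field_simp; ring
  have h2 : Real.log r = Real.log g + Real.log (ε₀ / 2) := by
    rw [hrdef, mul_div_assoc, Real.log_mul hg.ne' (by positivity)]
  have hmax : ε₀ ^ 2 / 8 - Real.log c - d * Real.log (ε₀ / 2) ≤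
      max 0 (ε₀ ^ 2 / 8 - Real.log c - d * Real.log (ε₀ / 2)) := le_max_right _ _
  rw [h1, h2, mul_add]
  linarith

include hρc hρu hdist hre in
/-- **DICTIONARY TO THE READER'S ITEM `B16B10Shape.CountertermData.ZLower`, FOR EVERY COMPACT GAUGE GROUP PRESENTED IN
`U(N)`.**  With `C_z ≥ 0` of `log_zNorm_ge_of_unitaryRep`: if the couplings of a `CountertermData S` lie in `]0, 1]`
(`SmallCouplings`), `S.dg = dim_ℝ 𝔤(ρ(G))` and `S.logz j = log z(g_j², ε₀)` (the reader's identification `α = g_j²`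
of (0.17)/(0.19)), then `S.ZLower C_z` — the hypothesis `hz` of `B16B10Shape.negE_lower` ∕ `unitConfigLog_of_leaves` ∕
`ep_lower_of_leaves` DISCHARGED for every such `G` (previously `U(N)`, `SU(N)` only), with `hCz : 0 ≤ 4|log σ₀| + C_z`
available from `0 ≤ C_z`. [cite: Balaban1987RG1, (0.15) p.254] -/
theorem zLower_of_unitaryRep {ε₀ : ℝ} (hε : 0 < ε₀) :
    ∃ Cz : ℝ, 0 ≤ Cz ∧ ∀ S : CountertermData, S.SmallCouplings →
      S.dg = Module.finrank ℝ (matrixLieAlgebra (Set.range ρ)) →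
      (∀ j, j < S.K → S.logz j = Real.log (zNorm G (S.g j ^ 2) ε₀)) → S.ZLower Cz := by
  obtain ⟨Cz, hCz, h⟩ := log_zNorm_ge_of_unitaryRep ρ hρc hρu hdist hre hε
  refine ⟨Cz, hCz, fun S hg hdg hz j hj => ?_⟩
  obtain ⟨hg0, hg1⟩ := hg j hj
  rw [hz j hj, hdg]
  exact h (S.g j) hg0 hg1

end General

/-! ## §3 The instances: `U(N)`, `SU(N)` re-derived, and presentations onto closed subgroups of `U(N)` -/

section Instances

variable {N : ℕ} [NeZero N]

omit [NeZero N] in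
/-- On `U(N)`, the presentation is the inclusion and the exponent is `dim 𝔲(N) = N²` (tree
`finrank_matrixLieAlgebra_unitaryGroup`). [cite: BrockerTomDieck1985, I (2.16)] -/
theorem finrank_matrixLieAlgebra_range_unitaryFundamentalRep :
    Module.finrank ℝ (matrixLieAlgebra (Set.range (unitaryFundamentalRep (Fin N) ℂ))) = N * N := by
  have hrange : Set.range (unitaryFundamentalRep (Fin N) ℂ) =
      (Matrix.unitaryGroup (Fin N) ℂ : Set (Matrix (Fin N) (Fin N) ℂ)) := by
    ext A
    constructor
    · rintro ⟨V, rfl⟩; exact V.2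
    · intro hA; exact ⟨⟨A, hA⟩, rfl⟩
  rw [hrange, finrank_matrixLieAlgebra_unitaryGroup, Fintype.card_fin, sq]

omit [NeZero N] in
/-- On `SU(N)`, the presentation is the inclusion and the exponent is `dim 𝔰𝔲(N) = N² − 1` (tree
`finrank_matrixLieAlgebra_specialUnitaryGroup`). [cite: BrockerTomDieck1985, I (2.18)] -/
theorem finrank_matrixLieAlgebra_range_fundamentalRep :
    Module.finrank ℝ (matrixLieAlgebra (Set.range (fundamentalRep (Fin N)))) = N * N - 1 := by
  have hrange : Set.range (fundamentalRep (Fin N)) =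
      (Matrix.specialUnitaryGroup (Fin N) ℂ : Set (Matrix (Fin N) (Fin N) ℂ)) := by
    ext A
    constructor
    · rintro ⟨V, rfl⟩; exact V.2
    · intro hA; exact ⟨⟨A, hA⟩, rfl⟩
  rw [hrange, finrank_matrixLieAlgebra_specialUnitaryGroup, Fintype.card_fin, sq]

/-- **`G = U(N)` as a corollary of §2** (the cell's instances `instGaugeGroupUnitaryGroup` = `GaugeGroup.ofUnitaryRep`
of the inclusion, `instRegularGaugeGroupUnitaryGroup`, `instHaarDataUnitaryGroup`; both interface hypotheses by
`rfl`): some `C_z ≥ 0` with `S.ZLower C_z` whenever `SmallCouplings`, `dg = N²`, `logz j = log z_{U(N)}(g_j², ε₀)` —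
`B16ZLower.zLower_of_unitaryGroup` (explicit `C_z`) is the sharper statement; this records that the general theorem
specialises to it. [cite: Balaban1987RG1, (0.15) p.254] -/
theorem zLower_unitaryGroup' {ε₀ : ℝ} (hε : 0 < ε₀) :
    ∃ Cz : ℝ, 0 ≤ Cz ∧ ∀ S : CountertermData, S.SmallCouplings → S.dg = N * N →
      (∀ j, j < S.K → S.logz j = Real.log (zNorm (Matrix.unitaryGroup (Fin N) ℂ) (S.g j ^ 2) ε₀)) →
        S.ZLower Cz := by
  obtain ⟨Cz, hCz, h⟩ := zLower_of_unitaryRep (G := Matrix.unitaryGroup (Fin N) ℂ)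
    (unitaryFundamentalRep (Fin N) ℂ) (continuous_unitaryFundamentalRep (Fin N) ℂ) (fun V => V.2)
    (fun _ => rfl) (fun _ => rfl) hε
  refine ⟨Cz, hCz, fun S hg hdg hz => h S hg ?_ hz⟩
  rw [hdg, finrank_matrixLieAlgebra_range_unitaryFundamentalRep]

/-- **`G = SU(N)` as a corollary of §2** (instances `instGaugeGroupSpecialUnitaryGroup`,
`instRegularGaugeGroupSpecialUnitaryGroup`, `instHaarDataSpecialUnitaryGroup`): some `C_z ≥ 0` with `S.ZLower C_z`
whenever `SmallCouplings`, `dg = N² − 1`, `logz j = log z_{SU(N)}(g_j², ε₀)` — `B16ZLower.zLower_of_specialUnitaryGroup`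
(explicit `C_z^{SU}`) is the sharper statement. [cite: Balaban1987RG1, (0.15) p.254] -/
theorem zLower_specialUnitaryGroup' {ε₀ : ℝ} (hε : 0 < ε₀) :
    ∃ Cz : ℝ, 0 ≤ Cz ∧ ∀ S : CountertermData, S.SmallCouplings → S.dg = N * N - 1 →
      (∀ j, j < S.K → S.logz j = Real.log (zNorm (Matrix.specialUnitaryGroup (Fin N) ℂ) (S.g j ^ 2) ε₀)) →
        S.ZLower Cz := by
  obtain ⟨Cz, hCz, h⟩ := zLower_of_unitaryRep (G := Matrix.specialUnitaryGroup (Fin N) ℂ)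
    (fundamentalRep (Fin N)) (continuous_fundamentalRep (Fin N)) fundamentalRep_mem_unitaryGroup
    (fun _ => rfl) (fun _ => rfl) hε
  refine ⟨Cz, hCz, fun S hg hdg hz => h S hg ?_ hz⟩
  rw [hdg, finrank_matrixLieAlgebra_range_fundamentalRep]

variable {G : Type*} [GaugeGroup G] [MeasurableSpace G] [RegularGaugeGroup G] [HaarData G]
  [TopologicalSpace G] [IsTopologicalGroup G] [CompactSpace G] [BorelSpace G]

/-- **A compact gauge group presented ONTO a closed subgroup `G′ ≤ U(N)`** («for example G ⊂ U(N)», the group read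
through a presentation `ρ` with `ρ(G) = G′`): the exponent is the dimension of the Lie algebra `𝐠` of `G′` in the
sense of gen 8's log-chart `unitarySubgroupLogChart G′` ([Hall2015] Def. 3.18), and `S.ZLower C_z` holds with
`dg = dim 𝐠`. [cite: Balaban1987RG1, §0 pp.251–252] -/
theorem zLower_of_range_eq_closedSubgroup (ρ : G →* Matrix (Fin N) (Fin N) ℂ) (hρc : Continuous ρ)
    (Gs : Subgroup (Matrix.unitaryGroup (Fin N) ℂ)) (hGs : IsClosed (Gs : Set (Matrix.unitaryGroup (Fin N) ℂ)))
    (hρG : Set.range ρ = (Subtype.val '' (Gs : Set (Matrix.unitaryGroup (Fin N) ℂ)) : Set (Matrix (Fin N) (Fin N) ℂ)))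
    (hdist : ∀ g : G, dist1 g = ‖ρ g - 1‖) (hre : ∀ g : G, reTr g = nReTr (ρ g)) {ε₀ : ℝ} (hε : 0 < ε₀) :
    ∃ Cz : ℝ, 0 ≤ Cz ∧ ∀ S : CountertermData, S.SmallCouplings →
      S.dg = Module.finrank ℝ (unitarySubgroupLogChart Gs hGs).lie →
      (∀ j, j < S.K → S.logz j = Real.log (zNorm G (S.g j ^ 2) ε₀)) → S.ZLower Cz := by
  have hρu : ∀ g, ρ g ∈ Matrix.unitaryGroup (Fin N) ℂ := by
    intro g
    have hg : ρ g ∈ Set.range ρ := ⟨g, rfl⟩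
    rw [hρG] at hg
    obtain ⟨u, -, hu⟩ := hg
    rw [← hu]
    exact u.2
  have hlie : (unitarySubgroupLogChart Gs hGs).lie = matrixLieAlgebra (Set.range ρ) := by
    rw [hρG]
    exact (unitarySubgroupLogChart Gs hGs).lie_eq_matrixLieAlgebra
  have hd : Module.finrank ℝ (unitarySubgroupLogChart Gs hGs).lie =
      Module.finrank ℝ (matrixLieAlgebra (Set.range ρ)) := by rw [hlie]
  obtain ⟨Cz, hCz, h⟩ := zLower_of_unitaryRep ρ hρc hρu hdist hre hε
  refine ⟨Cz, hCz, fun S hg hdg hz => h S hg ?_ hz⟩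
  rw [hdg, hd]

end Instances

/-! ## §4 Every closed subgroup of `U(N)` with the cell's canonical structures (`GaugeGroup.ofUnitaryRep`,
`HaarData.ofCompactGroup`): regularity and the item -/

section OfUnitaryRep

variable {n : Type*} [Fintype n] [DecidableEq n] [Nonempty n]
variable {H : Type*} [Group H] [TopologicalSpace H] [IsTopologicalGroup H] [MeasurableSpace H] [BorelSpace H]
  [SecondCountableTopology H]

/-- **Every second-countable topological group read through a continuous unitary representation is a
`RegularGaugeGroup`** for the structure `GaugeGroup.ofUnitaryRep H ρ hρ` (`dist1 = ‖ρ· − 1‖`, `reTr = Re Tr ρ·/N`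
continuous hence measurable; `|Re tr| ≤ 1`; multiplication/inversion jointly measurable on a second-countable Borel
group) — the regularity mixin's docstring («every closed subgroup of U(n) with its Borel σ-algebra satisfies them») as a
theorem, beyond the instances `U(n)`, `SU(n)`. [cite: Balaban1985Averaging, (19) p.21] -/
theorem regularGaugeGroup_ofUnitaryRep (ρ : H →* Matrix n n ℂ) (hρc : Continuous ρ)
    (hρ : ∀ h, ρ h ∈ Matrix.unitaryGroup n ℂ) :
    @RegularGaugeGroup H (GaugeGroup.ofUnitaryRep H ρ hρ) _ := by
  letI : GaugeGroup H := GaugeGroup.ofUnitaryRep H ρ hρ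
  exact
    { toMeasurableMul₂ := inferInstance
      toMeasurableInv := inferInstance
      measurable_dist1 := (continuous_opDist1.comp hρc).measurable
      measurable_reTr := (continuous_nReTr.comp hρc).measurable
      abs_reTr_le_one := fun h => abs_nReTr_le_one (hρ h) }

end OfUnitaryRep

section ClosedSubgroup

variable {N : ℕ} [NeZero N]

omit [NeZero N] in
/-- A closed subgroup of `U(N)` is second countable (subspace of `M_N(ℂ)`). [cite: Balaban1987RG1, §0 pp.251–252] -/
theorem secondCountableTopology_closedSubgroup (Gs : Subgroup (Matrix.unitaryGroup (Fin N) ℂ)) :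
    SecondCountableTopology Gs := by
  haveI := secondCountableTopology_matrix (n := Fin N)
  haveI : SecondCountableTopology (Matrix.unitaryGroup (Fin N) ℂ) :=
    Topology.IsEmbedding.subtypeVal.secondCountableTopology
  exact Topology.IsEmbedding.subtypeVal.secondCountableTopology

/-- **THE ITEM FOR EVERY CLOSED SUBGROUP `G ≤ U(N)` WITH THE CELL'S CANONICAL STRUCTURES** — `GaugeGroup.ofUnitaryRep`
of the inclusion `G ≤ U(N) ⊂ M_N(ℂ)` (B7 (19): `|·|` = operator norm, B12 (0.2): normalised trace), its regularity
(`regularGaugeGroup_ofUnitaryRep`), and the normalised Haar measure `HaarData.ofCompactGroup` (`G` compact as a closed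
subgroup of `U(N)`): there is `C_z ≥ 0` with `S.ZLower C_z` whenever `SmallCouplings`, `S.dg = dim 𝐠`
(`𝐠` = the Lie algebra of gen 8's `unitarySubgroupLogChart G`) and `S.logz j = log z_G(g_j², ε₀)` — print's «G ⊂ U(N)
a Lie subgroup … 𝐠» served for ALL closed `G`, hypothesis-free. [cite: Balaban1987RG1, (0.15) p.254] -/
theorem zLower_closedSubgroup (Gs : Subgroup (Matrix.unitaryGroup (Fin N) ℂ))
    (hGs : IsClosed (Gs : Set (Matrix.unitaryGroup (Fin N) ℂ))) {ε₀ : ℝ} (hε : 0 < ε₀) :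
    letI : GaugeGroup Gs := GaugeGroup.ofUnitaryRep Gs ((unitaryFundamentalRep (Fin N) ℂ).comp Gs.subtype)
      (fun g => (g : Matrix.unitaryGroup (Fin N) ℂ).2)
    letI : CompactSpace Gs := compactSpace_of_isClosed_subgroup Gs hGs
    letI : HaarData Gs := HaarData.ofCompactGroup Gs
    ∃ Cz : ℝ, 0 ≤ Cz ∧ ∀ S : CountertermData, S.SmallCouplings →
      S.dg = Module.finrank ℝ (unitarySubgroupLogChart Gs hGs).lie →
      (∀ j, j < S.K → S.logz j = Real.log (zNorm Gs (S.g j ^ 2) ε₀)) → S.ZLower Cz := by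
  set ρ : Gs →* Matrix (Fin N) (Fin N) ℂ := (unitaryFundamentalRep (Fin N) ℂ).comp Gs.subtype with hρdef
  have hρu : ∀ g : Gs, ρ g ∈ Matrix.unitaryGroup (Fin N) ℂ := fun g => (g : Matrix.unitaryGroup (Fin N) ℂ).2
  letI : GaugeGroup Gs := GaugeGroup.ofUnitaryRep Gs ρ hρu
  letI : CompactSpace Gs := compactSpace_of_isClosed_subgroup Gs hGs
  haveI : SecondCountableTopology Gs := secondCountableTopology_closedSubgroup Gs
  have hρc : Continuous ρ := continuous_subtype_val.comp continuous_subtype_val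
  haveI : RegularGaugeGroup Gs := regularGaugeGroup_ofUnitaryRep ρ hρc hρu
  letI : HaarData Gs := HaarData.ofCompactGroup Gs
  have hρG : Set.range ρ =
      (Subtype.val '' (Gs : Set (Matrix.unitaryGroup (Fin N) ℂ)) : Set (Matrix (Fin N) (Fin N) ℂ)) :=
    range_unitaryFundamentalRep_comp_subtype Gs
  exact zLower_of_range_eq_closedSubgroup (G := Gs) ρ hρc Gs hGs hρG (fun _ => rfl) (fun _ => rfl) hε

end ClosedSubgroup

end B16ZLowerCompactGroup

end Literature.MathematicalPhysics.QuantumFieldTheory.Balaban1983to89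

end
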